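import Summits.Ventures.Crystal3D.Theorems.StickyWulffConstantGenericWallFloorCapRigidity
import HarnessLib

/-!
# Hemisphere-three: at most three contacts on the open side of a complete contact hexagon (lane F line B, lemma M1)

HONEST FRAMING. Part of the venture `Summits/Ventures/Crystal3D` (cell `crystal3d-full`), helper for the crux
`CoaxialWallLaw` (stmt-Ventures-19481) of `route-Ventures-StickyWulffConstant`.  Rung credit only; F-C1 not moved.
Planner cf-p1's LINE B for lane F (memo F-TOPDOWN, 2026-08-28T06:05Z) bounds the adhesion a filling can RECOVER
from an exact grain; its lemma (M1) «HEMISPHERE-3» reads: a ball with six contacts forming a regular planar hexagon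
has at most THREE contacts in each open half-space of that plane.  `…GenericWallFloorCapRigidity.rung_hexCap`
already gives the cap inequality (a free-side contact direction `u` has `u₂² ≥ 2/3`); this file adds the COUNT:

* `card_le_three_of_polarCap` — frame-free: unit vectors with `⟪u, n⟫ > 0`, `⟪u, n⟫² ≥ 2/3` (polar cap of
  angular radius `35.26°` about a unit `n`) and pairwise `⟪u, u'⟫ ≤ ½` (non-overlapping contacts) are at most
  THREE.  Proof without angles: the in-plane parts `w = u − ⟪u,n⟫ n` have `‖w‖² ≤ 1/3` and pairwise
  `⟪w, w'⟫ ≤ ½ − 2/3 = −1/6`, so `0 ≤ ‖Σ w‖² ≤ k/3 − k(k−1)/6`, i.e. `k ≤ 3`.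
* `card_contacts_above_hexagon111_le_three` — the packing form in the `(111)`-face coordinates of
  `…CapRigidity` (hexagon `(±1,0,0), (±½,±√3/2,0)` around `x`, normal `e₃`): in a `1`-separated `X` containing
  the six hexagon balls of `x`, at most three balls of `X` touch `x` from the side `x₂' > x₂`.

Together with `fcc_offLattice_unitContacts_le_three` (`…NoReconstructionGainOffLattice`: a point off an fcc
lattice is at unit distance from at most three lattice points — line B's (M2) with `m(τ) = 3` for every `τ > 0`)
these are the two per-ball recovery caps of line B.

WHAT THIS IS NOT: not the stub; no wall statement; F-C1 not moved.
-/

noncomputable section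

namespace Summit.Ventures.Crystal3D.Theorems

open Finset
open scoped InnerProductSpace

/-- **At most three unit vectors in the polar cap `⟪u,n⟫² ≥ 2/3`, `⟪u,n⟫ > 0`, pairwise at `⟪u,u'⟫ ≤ ½`.**
See the module docstring. -/
theorem card_le_three_of_polarCap {n : EuclideanSpace ℝ (Fin 3)} (hn : ‖n‖ = 1)
    (S : Finset (EuclideanSpace ℝ (Fin 3))) (hu : ∀ u ∈ S, ‖u‖ = 1) (hup : ∀ u ∈ S, 0 < ⟪u, n⟫_ℝ)
    (hcap : ∀ u ∈ S, 2 / 3 ≤ ⟪u, n⟫_ℝ ^ 2) (hsep : ∀ u ∈ S, ∀ u' ∈ S, u ≠ u' → ⟪u, u'⟫_ℝ ≤ 1 / 2) :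
    S.card ≤ 3 := by
  classical
  -- in-plane parts
  set w : EuclideanSpace ℝ (Fin 3) → EuclideanSpace ℝ (Fin 3) := fun u => u - ⟪u, n⟫_ℝ • n with hw
  have hnn : ⟪n, n⟫_ℝ = 1 := by rw [real_inner_self_eq_norm_sq, hn, one_pow]
  have hww : ∀ u u' : EuclideanSpace ℝ (Fin 3), ⟪w u, w u'⟫_ℝ = ⟪u, u'⟫_ℝ - ⟪u, n⟫_ℝ * ⟪u', n⟫_ℝ := by
    intro u u'
    simp only [hw, inner_sub_left, inner_sub_right, real_inner_smul_left, real_inner_smul_right, hnn,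
      real_inner_comm n u']
    ring
  have hdiag : ∀ u ∈ S, ⟪w u, w u⟫_ℝ ≤ 1 / 3 := by
    intro u huS
    rw [hww, real_inner_self_eq_norm_sq, hu u huS, one_pow]
    have := hcap u huS
    nlinarith
  have hoff : ∀ u ∈ S, ∀ u' ∈ S, u ≠ u' → ⟪w u, w u'⟫_ℝ ≤ -(1 / 6) := by
    intro u huS u' hu'S hne
    rw [hww]
    have h1 := hsep u huS u' hu'S hne
    have hc := hcap u huS
    have hc' := hcap u' hu'S
    have hp := hup u huS
    have hp' := hup u' hu'S
    -- `⟪u,n⟫ ⟪u',n⟫ ≥ 2/3`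
    have hprod : 2 / 3 ≤ ⟪u, n⟫_ℝ * ⟪u', n⟫_ℝ := by nlinarith [mul_pos hp hp']
    linarith
  -- `0 ≤ ‖Σ w‖² = Σ_u (⟪w u, w u⟫ + Σ_{u' ≠ u} ⟪w u, w u'⟫) ≤ k/3 − k(k−1)/6`
  have hsq : 0 ≤ ⟪∑ u ∈ S, w u, ∑ u ∈ S, w u⟫_ℝ := real_inner_self_nonneg
  rw [sum_inner] at hsq
  have hrow : ∀ u ∈ S, ⟪w u, ∑ u' ∈ S, w u'⟫_ℝ ≤ 1 / 3 + ((S.card : ℝ) - 1) * (-(1 / 6)) := by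
    intro u huS
    rw [inner_sum, ← add_sum_erase S _ huS]
    have h2 : ∑ u' ∈ S.erase u, ⟪w u, w u'⟫_ℝ ≤ ∑ u' ∈ S.erase u, (-(1 / 6) : ℝ) :=
      sum_le_sum fun u' hu' => hoff u huS u' (mem_of_mem_erase hu') (ne_of_mem_erase hu').symm
    rw [sum_const, card_erase_of_mem huS, nsmul_eq_mul] at h2
    have hcast : (((S.card - 1 : ℕ)) : ℝ) = (S.card : ℝ) - 1 := by
      rw [Nat.cast_sub (card_pos.2 ⟨u, huS⟩)]; simp
    rw [hcast] at h2
    linarith [hdiag u huS]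
  have htot : ∑ u ∈ S, ⟪w u, ∑ u' ∈ S, w u'⟫_ℝ ≤ (S.card : ℝ) * (1 / 3 + ((S.card : ℝ) - 1) * (-(1 / 6))) := by
    have := sum_le_sum hrow
    rw [sum_const, nsmul_eq_mul] at this
    exact this
  have hk : (S.card : ℝ) * (1 / 3 + ((S.card : ℝ) - 1) * (-(1 / 6))) ≥ 0 := le_trans hsq htot
  have hk' : (S.card : ℝ) * ((S.card : ℝ) - 3) ≤ 0 := by nlinarith
  by_contra hlt
  push Not at hlt
  have h4 : (4 : ℝ) ≤ S.card := by exact_mod_cast hlt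
  nlinarith

/-- **Hemisphere-three in the `(111)`-face frame**: with the six hexagon balls `x + (±1,0,0)`, `x + (±½,±√3/2,0)`
present in a `1`-separated `X`, at most three balls of `X` touch `x` from the side `q₂ > x₂`.  See the module
docstring. -/
theorem card_contacts_above_hexagon111_le_three {X : Finset (EuclideanSpace ℝ (Fin 3))}
    (hX : ∀ p ∈ X, ∀ q ∈ X, p ≠ q → 1 ≤ dist p q) (x : EuclideanSpace ℝ (Fin 3))
    (hhex : ∀ h : EuclideanSpace ℝ (Fin 3), h 2 = 0 →
      ((h 0 = 1 ∧ h 1 = 0) ∨ (h 0 = -1 ∧ h 1 = 0) ∨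
        (h 0 = 1 / 2 ∧ h 1 = Real.sqrt 3 / 2) ∨ (h 0 = -(1 / 2) ∧ h 1 = -(Real.sqrt 3 / 2)) ∨
        (h 0 = 1 / 2 ∧ h 1 = -(Real.sqrt 3 / 2)) ∨ (h 0 = -(1 / 2) ∧ h 1 = Real.sqrt 3 / 2)) → x + h ∈ X) :
    (X.filter fun q => dist x q = 1 ∧ x 2 < q 2).card ≤ 3 := by
  classical
  set e₃ : EuclideanSpace ℝ (Fin 3) := EuclideanSpace.single (2 : Fin 3) (1 : ℝ) with he₃
  have he₃1 : ‖e₃‖ = 1 := by rw [he₃, PiLp.norm_single, norm_one]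
  have hin : ∀ u : EuclideanSpace ℝ (Fin 3), ⟪u, e₃⟫_ℝ = u 2 := by
    intro u; rw [he₃, EuclideanSpace.inner_single_right]; simp
  have h3 : Real.sqrt 3 ^ 2 = 3 := Real.sq_sqrt (by norm_num)
  -- the six hexagon vectors as functions
  have hexv : ∀ (a b : ℝ), a ^ 2 + b ^ 2 = 1 →
      (((a = 1 ∧ b = 0) ∨ (a = -1 ∧ b = 0) ∨ (a = 1 / 2 ∧ b = Real.sqrt 3 / 2) ∨
        (a = -(1 / 2) ∧ b = -(Real.sqrt 3 / 2)) ∨ (a = 1 / 2 ∧ b = -(Real.sqrt 3 / 2)) ∨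
        (a = -(1 / 2) ∧ b = Real.sqrt 3 / 2))) →
      ∀ q ∈ X, dist x q = 1 → x 2 < q 2 → a * (q - x) 0 + b * (q - x) 1 ≤ 1 / 2 := by
    intro a b hab hcase q hq hdq hup
    set h : EuclideanSpace ℝ (Fin 3) := EuclideanSpace.single (0 : Fin 3) a + EuclideanSpace.single (1 : Fin 3) b
      with hh
    have hh0 : h 0 = a := by simp [hh]
    have hh1 : h 1 = b := by simp [hh]
    have hh2 : h 2 = 0 := by simp [hh]
    have hhX : x + h ∈ X := hhex h hh2 (by rw [hh0, hh1]; exact hcase)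
    have hne : x + h ≠ q := by
      intro heq
      have : (x + h) 2 = q 2 := by rw [heq]
      rw [PiLp.add_apply, hh2, add_zero] at this
      linarith
    have hd := hX _ hhX q hq hne
    -- `dist (x+h) q ≥ 1` with `‖q − x‖ = 1`, `‖h‖ = 1` gives `⟪q − x, h⟫ ≤ ½`
    have hnormh : ‖h‖ ^ 2 = 1 := by
      rw [EuclideanSpace.norm_eq, Real.sq_sqrt (by positivity)]
      simp [Fin.sum_univ_three, hh0, hh1, hh2]
      nlinarith [hab]
    have hqx : ‖q - x‖ = 1 := by rw [← dist_eq_norm, dist_comm]; exact hdq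
    have hd' : 1 ≤ ‖(q - x) - h‖ := by
      rw [dist_eq_norm] at hd
      rw [show q - x - h = -(x + h - q) by abel, norm_neg]; exact hd
    have hsq : 1 ≤ ‖(q - x) - h‖ ^ 2 := by nlinarith [norm_nonneg ((q - x) - h)]
    rw [norm_sub_sq_real, hqx, hnormh] at hsq
    have hinner : ⟪q - x, h⟫_ℝ = a * (q - x) 0 + b * (q - x) 1 := by
      rw [hh, inner_add_right, EuclideanSpace.inner_single_right, EuclideanSpace.inner_single_right]
      simp
    linarith
  refine card_le_three_of_polarCap he₃1 ((X.filter fun q => dist x q = 1 ∧ x 2 < q 2).image fun q => q - x)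
    ?_ ?_ ?_ ?_ |>.trans' ?_
  · intro u hu
    obtain ⟨q, hq, rfl⟩ := mem_image.1 hu
    obtain ⟨-, hdq, -⟩ := mem_filter.1 hq
    rw [← dist_eq_norm, dist_comm]; exact hdq
  · intro u hu
    obtain ⟨q, hq, rfl⟩ := mem_image.1 hu
    obtain ⟨-, -, hlt⟩ := mem_filter.1 hq
    rw [hin, PiLp.sub_apply]; linarith
  · intro u hu
    obtain ⟨q, hq, rfl⟩ := mem_image.1 hu
    obtain ⟨hqX, hdq, hlt⟩ := mem_filter.1 hq
    rw [hin]
    have hu1 : ‖q - x‖ = 1 := by rw [← dist_eq_norm, dist_comm]; exact hdq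
    have hs3 : (0 : ℝ) < Real.sqrt 3 / 2 := by positivity
    refine rung_hexCap (q - x) hu1 ?_ ?_ ?_
    · rw [abs_le]; constructor
      · have := hexv (-1) 0 (by norm_num) (Or.inr (Or.inl ⟨rfl, rfl⟩)) q hqX hdq hlt; linarith
      · have := hexv 1 0 (by norm_num) (Or.inl ⟨rfl, rfl⟩) q hqX hdq hlt; linarith
    · rw [abs_le]; constructor
      · have := hexv (-(1 / 2)) (-(Real.sqrt 3 / 2)) (by nlinarith [h3])
          (Or.inr (Or.inr (Or.inr (Or.inl ⟨rfl, rfl⟩)))) q hqX hdq hlt; linarith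
      · have := hexv (1 / 2) (Real.sqrt 3 / 2) (by nlinarith [h3])
          (Or.inr (Or.inr (Or.inl ⟨rfl, rfl⟩))) q hqX hdq hlt; linarith
    · rw [abs_le]; constructor
      · have := hexv (-(1 / 2)) (Real.sqrt 3 / 2) (by nlinarith [h3])
          (Or.inr (Or.inr (Or.inr (Or.inr (Or.inr ⟨rfl, rfl⟩))))) q hqX hdq hlt; linarith
      · have := hexv (1 / 2) (-(Real.sqrt 3 / 2)) (by nlinarith [h3])
          (Or.inr (Or.inr (Or.inr (Or.inr (Or.inl ⟨rfl, rfl⟩))))) q hqX hdq hlt; linarith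
  · intro u hu u' hu' hne
    obtain ⟨q, hq, rfl⟩ := mem_image.1 hu
    obtain ⟨q', hq', rfl⟩ := mem_image.1 hu'
    obtain ⟨hqX, hdq, -⟩ := mem_filter.1 hq
    obtain ⟨hq'X, hdq', -⟩ := mem_filter.1 hq'
    have hqq : q ≠ q' := fun h => hne (by rw [h])
    have hd := hX q hqX q' hq'X hqq
    have h1 : ‖q - x‖ = 1 := by rw [← dist_eq_norm, dist_comm]; exact hdq
    have h2 : ‖q' - x‖ = 1 := by rw [← dist_eq_norm, dist_comm]; exact hdq'
    have hsq : 1 ≤ ‖(q - x) - (q' - x)‖ ^ 2 := by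
      rw [show q - x - (q' - x) = q - q' by abel, ← dist_eq_norm]; nlinarith [hd]
    rw [norm_sub_sq_real, h1, h2] at hsq
    linarith
  · apply le_of_eq
    refine (card_image_of_injOn fun q _ q' _ h => ?_).symm
    simpa using h

end Summit.Ventures.Crystal3D.Theorems

end
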